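import Summits.KontsevichZagierPeriods.KontsevichZagierPeriods.Theorems.TerasomaMultiplicationDasGapTwelve
import Summits.KontsevichZagierPeriods.KontsevichZagierPeriods.Theorems.DasGapTwelve.Negative.LoadBearing

/-!
# `DasGapTwelve` — the scaled family at the true constant

Corollary of the closing theorem `DasGapTwelve_of` (line `picard-involution-quotient`) for the
one-parameter family `DasGapTwelveScaled c` of `Theorems/DasGapTwelve/Negative/LoadBearing.lean`
(the crux with `c₀` replaced by a real parameter `c`; false for every `c ≤ 1` by
`not_equivalent_of_le_one`): the member at `c = c₀ = 2^(−1/4)·3^(3/8)·√(1+√3)` HOLDS, and `c₀` is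
the unique such constant (`constant_unique`). [Kontsevich–Zagier 2001, §1.2]
-/

namespace Summit.KontsevichZagierPeriods.TerasomaMultiplication.DasGapTwelve

open Summit.KontsevichZagierPeriods.TerasomaMultiplication.DasGapTwelveNegative

/-- Re-export of the closing theorem under the route-local name (the crux holds). [folklore] -/
theorem dasGapTwelve_holds :
    Summit.KontsevichZagierPeriods.KontsevichZagierPeriods.Theses.TerasomaMultiplication.DasGapTwelve :=
  DasGapTwelve_of

/-- The scaled Das-gap family holds at the true constant `c₀`: `DasGapTwelveScaled c₀`
(definitionally the crux, `dasGapTwelve_iff_scaled`), by `DasGapTwelve_of`. [folklore] -/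
theorem dasGapTwelveScaled_c₀ : DasGapTwelveScaled c₀ :=
  dasGapTwelve_iff_scaled.mp DasGapTwelve_of

end Summit.KontsevichZagierPeriods.TerasomaMultiplication.DasGapTwelve
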